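import Summits.ABC.IUTFork.Joshi.ThetaLocusSaturation
import Summits.ABC.IUTFork.Joshi.ThetaValuesLocusModelPadic
import HarnessLib

/-!
# A second, FROBENIUS-BIJECTIVE kernel model of E-t3's [J-IIp] carriers `PeriodRingDatum` / `PrototypeDatum` /
# `CanonicalPoint` / `RootTower`: the EXPONENT MODEL (points = valuation exponents `ℚ`, Frobenius = multiplication by `p`)

Test-side support file of the abc-iut cell, block E «type Joshi's construction, test vs S» (rung LADDER-ABC:A2.E; seat
abc-iut-E-t57, batch-3 «[J-IIp] DERIVABLE/SUPPLIER seat»; default item announced on STATUS 2026-08-26T09:1xZ). Companion of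
abc-iut-E-t3's O1 vacuity model `Joshi/TestThetaValuesLocusModel.lean` (E-plan-2 ruling 07:28:52Z; its p-adic toolkit
`Joshi/ThetaValuesLocusModelPadic.lean`, p-id on E-t3's line, is imported BY NAME: `Model.normExp`, `Model.exists_norm_eq_norm_rpow`,
`Model.absPow`, `Model.absOne`). PURPOSE — three items, none of them a claim about Joshi's or Mochizuki's mathematics:

1. A model of the hypothesis structures of `Joshi/ThetaValuesLocus.lean` (p427971), `Joshi/PrimitiveAnsatz.lean` (p428639),
   `Joshi/ThetaLocusPrototype.lean` (p429136), `Joshi/ThetaLocusSaturation.lean` (p430929) in which the POINT-FROBENIUS IS A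
   BIJECTION and the "tilt" has `p`-th ROOTS — the two binders of this seat's gluing certificates `AdelicCurveDatum.PrototypeSupply` /
   `PrototypeFamily` (`Joshi/AdelicAnsatzLocalSupply.lean`, p432358), which E-t3's model over `Y := Q̄_p`, `ϕ(y) := y^p` cannot meet
   (`y ↦ y^p` is not injective on `Q̄_p`: `ζ·a ↦ a^p` for `ζ^p = 1`; a characteristic-`0` artefact of «the signature does not record
   `char F = p`»). Here `Y := ℚ` and `ϕ(r) := p·r`.
2. An independent second non-vacuity witness for the [J-IIp] carriers (different seat, different point space).
3. A LOCATED observation for the faithfulness referees (no verdict): the typed [J-IIp] signature is satisfied by a model that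
   retains NOTHING BUT VALUATION EXPONENTS — points are exponents `r ∈ ℚ`, the point of `[a] − p` is `e(a) = log‖a‖/log‖p‖`, the
   Ansatz tuple of `a` is `(e, 4e, 9e, …)`, Frobenius is `e ↦ p·e`, `K_r = Q̄_p` with `‖·‖^{r}` — so every kernel theorem over
   `PrototypeDatum` (Thm. 6.9.1, Lem. 8.4.1, Prop. 9.4.1, Thm. 9.2.1, the saturation `|Θ̃|_B ≥ 1`, …) is exponent bookkeeping; no
   arithmetic of `B` or of `Y_{F,ℚ_p}` is pinned by the typing.

THE MODEL (logical, not arithmetic-faithful; same ambient field as E-t3's). `F = E0 = K_r := Q̄_p = PadicAlgCl p` (Mathlib's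
algebraic closure of `ℚ_p` with the spectral norm), `|−|_F = |−|_0 := ‖·‖`; `Y := ℚ`; `pt a := e(a) := −normExp a` for
`0 < ‖a‖ < 1` (so `‖p‖^{e(a)} = ‖a‖`, axiom (A4)) and `0` otherwise; `frobY r := p·r` (then `pt (a^p) = p·pt a` for EVERY `a`);
Galois trivial; `scale r := r` for `r > 0`, `:= 1` otherwise; `|−|_{K_r} := ‖·‖^{scale r}` (E-t3's `absPow`); `ι_r := id`;
`B := ℚ → Q̄_p` with `η_r` = evaluation at `r`, `φ := id` on `B`, `|b|_ρ := ‖b(1)‖`, `T_r := {0}`; Teichmüller map `x ↦ (r ↦ x·c_r(‖x‖))`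
a sphere-wise rescaling with `‖c_r(ρ)‖ = ρ^{1/scale r − 1}` (exists because all exponents are RATIONAL — this is why `Y := ℚ`), so
that `‖[x](r)‖^{scale r} = ‖x‖` (A1) and `[−](r)` is onto (A2); `ℓ⋆ := 2`, `q_E := p^{10}`, `ξ := p`; canonical point `t := p`
(`pt p = 1`), `a := p^{1/4}`; root tower `t^{1/N} :=` an `N`-th root of `p`. [folklore]
-/

noncomputable section

open Set

namespace Summit.ABC.IUTFork.Joshi.ExpModel

open Summit.ABC.IUTFork.Joshi.Model

variable (p : ℕ) [hp : Fact p.Prime]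

/-! ## 0. Local `p`-adic bookkeeping (the `private` facts of E-t3's toolkit, re-derived as `private` — the same statements exist
elsewhere in the tree, e.g. `Literature.NumberTheory.GaloisRepresentations.PadicAlgCl.norm_natCast_prime_pos_lt_one`; not re-exported) -/

/-- `1 < p` in `ℝ`. [folklore] -/
private theorem one_lt_p : (1 : ℝ) < (p : ℝ) := by exact_mod_cast hp.out.one_lt

/-- `0 < p` in `ℝ`. [folklore] -/
private theorem p_pos : (0 : ℝ) < (p : ℝ) := lt_trans one_pos (one_lt_p p)

/-- `‖p‖ = p⁻¹` in `Q̄_p`. [folklore] -/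
private theorem norm_p : ‖(p : PadicAlgCl p)‖ = (p : ℝ)⁻¹ := by
  rw [← map_natCast (algebraMap ℚ_[p] (PadicAlgCl p)), ← PadicAlgCl.coe_eq]
  show ‖((p : ℚ_[p]) : PadicAlgCl p)‖ = _
  rw [PadicAlgCl.norm_extends, Padic.norm_p]

/-- `‖p‖ = p^{−1}` as a real power. [folklore] -/
private theorem norm_p_rpow : ‖(p : PadicAlgCl p)‖ = (p : ℝ) ^ (((-1 : ℚ) : ℝ)) := by
  rw [norm_p]; push_cast; rw [Real.rpow_neg_one]

/-- `0 < ‖p‖ < 1`. [folklore] -/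
private theorem norm_p_pos_lt_one : 0 < ‖(p : PadicAlgCl p)‖ ∧ ‖(p : PadicAlgCl p)‖ < 1 := by
  rw [norm_p]
  exact ⟨inv_pos.2 (p_pos p), inv_lt_one_of_one_lt₀ (one_lt_p p)⟩

/-- `(p : Q̄_p) ≠ 0`. [folklore] -/
private theorem p_ne_zero : (p : PadicAlgCl p) ≠ 0 := fun h => by
  have := (norm_p_pos_lt_one p).1
  rw [h, norm_zero] at this
  exact lt_irrefl _ this

/-- Real powers of `p` determine their exponents. [folklore] -/
theorem rpow_p_inj {s t : ℝ} (h : (p : ℝ) ^ s = (p : ℝ) ^ t) : s = t := by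
  have := congrArg Real.log h
  rw [Real.log_rpow (p_pos p), Real.log_rpow (p_pos p)] at this
  exact mul_right_cancel₀ (Real.log_pos (one_lt_p p)).ne' this

/-- The norm exponent is DETERMINED by the norm: `‖x‖ = p^q ⟹ normExp x = q`. [folklore] -/
theorem normExp_eq_of_norm_eq {x : PadicAlgCl p} (hx : x ≠ 0) {q : ℚ} (h : ‖x‖ = (p : ℝ) ^ (q : ℝ)) : normExp p x = q := by
  have h' := norm_eq_rpow_normExp p hx
  rw [h] at h'
  exact_mod_cast (rpow_p_inj p h').symm

/-- `normExp p = −1`. [folklore] -/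
theorem normExp_p : normExp p (p : PadicAlgCl p) = -1 :=
  normExp_eq_of_norm_eq p (p_ne_zero p) (norm_p_rpow p)

/-- `normExp (xⁿ) = n · normExp x`. [folklore] -/
theorem normExp_pow {x : PadicAlgCl p} (hx : x ≠ 0) (n : ℕ) : normExp p (x ^ n) = n * normExp p x := by
  apply normExp_eq_of_norm_eq p (pow_ne_zero n hx)
  rw [norm_pow, norm_eq_rpow_normExp p hx, ← Real.rpow_natCast, ← Real.rpow_mul (p_pos p).le]
  push_cast
  ring_nf

/-! ## 1. The point map `a ↦ e(a)` (valuation exponent) and the scales -/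

open scoped Classical in
/-- The POINT of `[a] − p` in the model: the valuation exponent `e(a) = −normExp a = log‖a‖/log‖p‖` for `0 < ‖a‖ < 1` (so that
`‖p‖^{e(a)} = ‖a‖`), and `0` for `a` outside `𝔪 ∖ 0` (junk value compatible with Frobenius: `p · 0 = 0`). [folklore] -/
def expQ (a : PadicAlgCl p) : ℚ := if 0 < ‖a‖ ∧ ‖a‖ < 1 then -normExp p a else 0

/-- On `𝔪 ∖ 0`, `e(a) = −normExp a`. [folklore] -/
theorem expQ_of_mem {a : PadicAlgCl p} (h0 : 0 < ‖a‖) (h1 : ‖a‖ < 1) : expQ p a = -normExp p a := by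
  unfold expQ; rw [if_pos ⟨h0, h1⟩]

/-- `e(a) > 0` on `𝔪 ∖ 0` (`p^{normExp a} = ‖a‖ < 1` with `p > 1` forces `normExp a < 0`). [folklore] -/
theorem expQ_pos {a : PadicAlgCl p} (h0 : 0 < ‖a‖) (h1 : ‖a‖ < 1) : 0 < expQ p a := by
  rw [expQ_of_mem p h0 h1, neg_pos]
  by_contra hge
  push Not at hge
  have h := norm_eq_rpow_normExp p (norm_pos_iff.1 h0)
  have : (1 : ℝ) ≤ (p : ℝ) ^ ((normExp p a : ℚ) : ℝ) := Real.one_le_rpow (one_lt_p p).le (by exact_mod_cast hge)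
  linarith

/-- **(A4) in the model**: `‖p‖^{e(a)} = ‖a‖` on `𝔪 ∖ 0`. [folklore] -/
theorem norm_p_rpow_expQ {a : PadicAlgCl p} (h0 : 0 < ‖a‖) (h1 : ‖a‖ < 1) :
    ‖(p : PadicAlgCl p)‖ ^ ((expQ p a : ℚ) : ℝ) = ‖a‖ := by
  rw [expQ_of_mem p h0 h1, norm_p, Real.inv_rpow (p_pos p).le, ← Real.rpow_neg (p_pos p).le,
    norm_eq_rpow_normExp p (norm_pos_iff.1 h0)]
  push_cast
  ring_nf

/-- **`e(aⁿ) = n·e(a)` for EVERY `a`** (`n ≥ 1`): on `𝔪 ∖ 0` by `normExp_pow`, elsewhere both sides are the junk value `0`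
(`aⁿ ∉ 𝔪 ∖ 0` as well). This is what makes `pt_frob` / `pt`–Frobenius compatibility hold for the model point map with
`ϕ(r) = p·r`. [folklore] -/
theorem expQ_pow (a : PadicAlgCl p) {n : ℕ} (hn : n ≠ 0) : expQ p (a ^ n) = n * expQ p a := by
  by_cases h : 0 < ‖a‖ ∧ ‖a‖ < 1
  · have hn0 : 0 < ‖a ^ n‖ := by rw [norm_pow]; exact pow_pos h.1 n
    have hn1 : ‖a ^ n‖ < 1 := by rw [norm_pow]; exact pow_lt_one₀ h.1.le h.2 hn
    rw [expQ_of_mem p hn0 hn1, expQ_of_mem p h.1 h.2, normExp_pow p (norm_pos_iff.1 h.1) n]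
    ring
  · have h' : ¬ (0 < ‖a ^ n‖ ∧ ‖a ^ n‖ < 1) := by
      rintro ⟨hn0, hn1⟩
      rw [norm_pow] at hn0 hn1
      refine h ⟨?_, ?_⟩
      · rcases (norm_nonneg a).eq_or_lt with h0 | h0
        · rw [← h0, zero_pow hn] at hn0; exact absurd hn0 (lt_irrefl 0)
        · exact h0
      · by_contra hge
        push Not at hge
        exact absurd hn1 (not_lt.2 (one_le_pow₀ hge))
    unfold expQ
    rw [if_neg h, if_neg h', mul_zero]

/-- `e(p) = 1`: the canonical point `t = p` carries the untwisted absolute value. [folklore] -/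
theorem expQ_p : expQ p (p : PadicAlgCl p) = 1 := by
  rw [expQ_of_mem p (norm_p_pos_lt_one p).1 (norm_p_pos_lt_one p).2, normExp_p]; norm_num

open scoped Classical in
/-- The SCALE of the point `r`: `r` itself for `r > 0`, junk value `1` otherwise (the signature asks `scale > 0` everywhere). [folklore] -/
def sc (r : ℚ) : ℝ := if 0 < r then (r : ℝ) else 1

/-- `sc r > 0`. [folklore] -/
theorem sc_pos (r : ℚ) : 0 < sc r := by
  unfold sc; split_ifs with h
  · exact_mod_cast h
  · exact one_pos

/-- `sc r = r` for `r > 0`. [folklore] -/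
theorem sc_of_pos {r : ℚ} (h : 0 < r) : sc r = r := by unfold sc; rw [if_pos h]

open scoped Classical in
/-- The (rational) rescaling exponent `1/sc r − 1`. [folklore] -/
def rexp (r : ℚ) : ℚ := if 0 < r then 1 / r - 1 else 0

/-- `1/sc r − 1 = rexp r` (both branches). [folklore] -/
theorem one_div_sc_sub_one (r : ℚ) : 1 / sc r - 1 = ((rexp r : ℚ) : ℝ) := by
  unfold sc rexp; split_ifs with h
  · push_cast; ring
  · push_cast; ring

/-! ## 2. The Teichmüller / untilt map at the point `r`: a sphere-wise rescaling with rational exponent -/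

open scoped Classical in
/-- The rescaling constant `c_r(ρ)`: a nonzero element of norm `ρ^{1/sc r − 1}` when one exists, else `1`. [folklore] -/
def cfun (r : ℚ) (ρ : ℝ) : PadicAlgCl p :=
  if h : ∃ c : PadicAlgCl p, c ≠ 0 ∧ ‖c‖ = ρ ^ (1 / sc r - 1) then h.choose else 1

/-- For `ρ = ‖x‖`, `x ≠ 0`, the constant exists (rational exponent, E-t3's `exists_norm_eq_norm_rpow`): `c_r(‖x‖) ≠ 0` and
`‖c_r(‖x‖)‖ = ‖x‖^{1/sc r − 1}`. [folklore] -/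
theorem cfun_spec (r : ℚ) {x : PadicAlgCl p} (hx : x ≠ 0) :
    cfun p r ‖x‖ ≠ 0 ∧ ‖cfun p r ‖x‖‖ = ‖x‖ ^ (1 / sc r - 1) := by
  have h : ∃ c : PadicAlgCl p, c ≠ 0 ∧ ‖c‖ = ‖x‖ ^ (1 / sc r - 1) := by
    rw [one_div_sc_sub_one]; exact exists_norm_eq_norm_rpow p hx (rexp r)
  unfold cfun
  rw [dif_pos h]
  exact h.choose_spec

/-- The Teichmüller map read at the point `r`: `x ↦ x · c_r(‖x‖)`. [folklore] -/
def lift (r : ℚ) (x : PadicAlgCl p) : PadicAlgCl p := x * cfun p r ‖x‖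

/-- `‖lift r x‖ = ‖x‖^{1/sc r}`. [folklore] -/
theorem norm_lift (r : ℚ) (x : PadicAlgCl p) : ‖lift p r x‖ = ‖x‖ ^ (1 / sc r) := by
  unfold lift
  by_cases hx : x = 0
  · rw [hx, zero_mul, norm_zero, Real.zero_rpow (one_div_pos.2 (sc_pos r)).ne']
  · rw [norm_mul, (cfun_spec p r hx).2]
    have hxpos : 0 < ‖x‖ := norm_pos_iff.2 hx
    calc ‖x‖ * ‖x‖ ^ (1 / sc r - 1) = ‖x‖ ^ (1 : ℝ) * ‖x‖ ^ (1 / sc r - 1) := by rw [Real.rpow_one]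
      _ = ‖x‖ ^ (1 + (1 / sc r - 1)) := (Real.rpow_add hxpos _ _).symm
      _ = ‖x‖ ^ (1 / sc r) := by ring_nf

/-- **(A1) in the model**: `‖lift r x‖^{sc r} = ‖x‖`. [folklore] -/
theorem norm_lift_rpow (r : ℚ) (x : PadicAlgCl p) : ‖lift p r x‖ ^ sc r = ‖x‖ := by
  rw [norm_lift, ← Real.rpow_mul (norm_nonneg x), one_div_mul_cancel (sc_pos r).ne', Real.rpow_one]

/-- **(A2) in the model**: `lift r` is onto. [folklore] -/
theorem lift_surjective (r : ℚ) (ξ : PadicAlgCl p) : ∃ x : PadicAlgCl p, lift p r x = ξ := by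
  by_cases hξ : ξ = 0
  · exact ⟨0, by rw [hξ]; unfold lift; rw [zero_mul]⟩
  · -- an element `x₀` of norm `‖ξ‖^{sc r}` (rational exponent), then correct `ξ` by the constant at that sphere
    have hsc : ∃ q : ℚ, sc r = (q : ℝ) := by
      unfold sc; split_ifs
      · exact ⟨r, rfl⟩
      · exact ⟨1, by push_cast; rfl⟩
    obtain ⟨q, hq⟩ := hsc
    obtain ⟨x₀, hx₀, hx₀n⟩ := exists_norm_eq_norm_rpow p hξ q
    have hρ : ‖x₀‖ = ‖ξ‖ ^ sc r := by rw [hx₀n, hq]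
    obtain ⟨hc0, hcn⟩ := cfun_spec p r hx₀
    refine ⟨ξ / cfun p r ‖x₀‖, ?_⟩
    have hξpos : 0 < ‖ξ‖ := norm_pos_iff.2 hξ
    have hn : ‖ξ / cfun p r ‖x₀‖‖ = ‖x₀‖ := by
      rw [norm_div, hcn, hρ, ← Real.rpow_mul hξpos.le, div_eq_iff (Real.rpow_pos_of_pos hξpos _).ne',
        ← Real.rpow_add hξpos]
      conv_lhs => rw [← Real.rpow_one ‖ξ‖]
      congr 1
      field_simp [(sc_pos r).ne']
      ring
    unfold lift
    rw [hn, div_mul_cancel₀ _ hc0]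

/-- At the point `r = 1` the Teichmüller map preserves norms (`sc 1 = 1`). [folklore] -/
theorem norm_lift_one (x : PadicAlgCl p) : ‖lift p 1 x‖ = ‖x‖ := by
  rw [norm_lift, sc_of_pos one_pos]; push_cast; rw [div_one, Real.rpow_one]

/-! ## 3. The model of `PeriodRingDatum`: points `ℚ`, Frobenius `r ↦ p·r` -/

/-- **The exponent-model period-ring datum** (dictionary of choices in the module docstring). [folklore] -/
def periodRingDatum : PeriodRingDatum (PadicAlgCl p) (ℚ → PadicAlgCl p) (PadicAlgCl p) ℚ (fun _ => PadicAlgCl p) Unit where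
  p := p
  p_prime := hp.out
  absF := absOne p
  norm _ b := ‖b 1‖
  norm_nonneg _ b := norm_nonneg _
  norm_add_le _ b b' := PadicAlgCl.isNonarchimedean p _ _
  teich x := fun r => lift p r x
  norm_teich ρ x _ _ := by
    show ‖lift p 1 x‖ = absOne p x
    rw [absOne_apply, norm_lift_one]
  gal _ := id
  frob := id
  gal_norm_one _ _ h := h
  frob_norm_one _ h := h
  absK r := absPow p (sc r) (sc_pos r)
  eta r := Pi.evalRingHom (fun _ : ℚ => PadicAlgCl p) r
  absK_eta_teich r x := by
    show ‖lift p r x‖ ^ sc r = ‖x‖ ^ (1 : ℝ)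
    rw [Real.rpow_one]; exact norm_lift_rpow p r x
  exists_teich_lift r ξ _ := lift_surjective p r ξ
  T _ := {0}
  zero_mem_T _ := rfl
  eta_T r τ hτ := by rw [Set.mem_singleton_iff.1 hτ]; rfl
  T_norm_one r τ hτ := by rw [Set.mem_singleton_iff.1 hτ]; simp
  pt := expQ p
  frobY r := p * r
  pt_frob a := by
    show expQ p (a ^ p) = (p : ℚ) * expQ p a
    exact expQ_pow p a hp.out.ne_zero
  galF _ := RingHom.id _
  absF_galF _ _ := rfl
  galY _ := id
  pt_gal _ _ := rfl
  abs0 := absOne p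
  abs0_p := by rw [absOne_apply]; exact norm_p_pos_lt_one p
  emb _ := RingHom.id _
  scale r := sc r
  scale_pos r := sc_pos r
  absK_emb r z := by
    show ‖z‖ ^ sc r = (absOne p z) ^ sc r
    rw [absOne_apply]
  absK_pt a ha0 ha1 := by
    show ‖(p : PadicAlgCl p)‖ ^ sc (expQ p a) = absOne p a
    rw [absOne_apply] at ha1 ⊢
    have h0 : 0 < ‖a‖ := norm_pos_iff.2 ha0
    rw [sc_of_pos (expQ_pos p h0 ha1), norm_p_rpow_expQ p h0 ha1]

/-- **The point-Frobenius of the exponent model is a BIJECTION** (`r ↦ p·r` on `ℚ`) — the binder `frobY_bijective` of this seat's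
`PrototypeFamily` (p432358), unavailable in a model with `ϕ(y) = y^p` on `Q̄_p`. [folklore] -/
theorem frobY_bijective : Function.Bijective (periodRingDatum p).frobY := by
  have hp0 : (p : ℚ) ≠ 0 := by exact_mod_cast hp.out.ne_zero
  refine ⟨fun r s h => mul_left_cancel₀ hp0 h, fun s => ⟨s / p, ?_⟩⟩
  show (p : ℚ) * (s / p) = s
  rw [mul_div_cancel₀ _ hp0]

/-- **`p`-th roots exist in the model tilt** (`Q̄_p` is algebraically closed) — the binder `perfect` of `PrototypeSupply` /
`PrototypeFamily` (p432358). [folklore] -/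
theorem exists_pth_root (b : PadicAlgCl p) : ∃ a : PadicAlgCl p, a ^ (periodRingDatum p).p = b :=
  IsAlgClosed.exists_pow_nat_eq b hp.out.pos

/-! ## 4. The model of `PrototypeDatum`, its canonical point and root tower -/

open scoped Classical in
/-- An `N`-th root of `p` in `Q̄_p` (`N ≥ 1`; a choice). [folklore] -/
def rootP (N : ℕ) : PadicAlgCl p :=
  if hN : 0 < N then (IsAlgClosed.exists_pow_nat_eq (p : PadicAlgCl p) hN).choose else 1

/-- `(rootP N)^N = p` for `N ≥ 1`. [folklore] -/
theorem rootP_pow {N : ℕ} (hN : 0 < N) : rootP p N ^ N = (p : PadicAlgCl p) := by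
  unfold rootP; rw [dif_pos hN]; exact (IsAlgClosed.exists_pow_nat_eq (p : PadicAlgCl p) hN).choose_spec

/-- **The exponent-model prototype datum**: `ℓ⋆ = 2` (`ℓ = 5`), `q_E := p^{10}`, `ξ := p` (`|ξ|_0 = |q|_0^{1/10} = |q|_0^{1/(2ℓ)}`). [folklore] -/
def prototypeDatum : PrototypeDatum (PadicAlgCl p) (ℚ → PadicAlgCl p) (PadicAlgCl p) ℚ (fun _ => PadicAlgCl p) Unit where
  toPeriodRingDatum := periodRingDatum p
  lstar := 2
  one_le_lstar := by norm_num
  q := (p : PadicAlgCl p) ^ 10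
  abs0_q := by
    show 0 < absOne p _ ∧ absOne p _ < 1
    rw [absOne_apply, norm_pow]
    exact ⟨pow_pos (norm_p_pos_lt_one p).1 _, pow_lt_one₀ (norm_nonneg _) (norm_p_pos_lt_one p).2 (by norm_num)⟩
  xi := p
  abs0_xi := by
    show absOne p (p : PadicAlgCl p) = (absOne p ((p : PadicAlgCl p) ^ 10)) ^ (1 / (2 * ((2 * 2 + 1 : ℕ) : ℝ)))
    rw [absOne_apply, absOne_apply, norm_pow]
    have h : (1 / (2 * ((2 * 2 + 1 : ℕ) : ℝ))) = ((10 : ℕ) : ℝ)⁻¹ := by norm_num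
    rw [h, Real.pow_rpow_inv_natCast (norm_nonneg _) (by norm_num)]

/-- In the model the ANSATZ TUPLE of `a` is the tuple of exponents `(e(a), 4·e(a), 9·e(a), …)` — [J-IIp] Thm. 6.9.1
`v_{K_j}(p) = j²·v_{K_1}(p)` is visible on the nose. [folklore] -/
theorem ansatzPt_eq (a : PadicAlgCl p) (i : Fin (prototypeDatum p).lstar) :
    (prototypeDatum p).ansatzPt a i = ((((i : ℕ) + 1) ^ 2 : ℕ) : ℚ) * expQ p a := by
  show expQ p (a ^ ((i : ℕ) + 1) ^ 2) = _
  exact expQ_pow p a (by positivity)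

/-- **The model canonical point**: `t = p` (point `e(p) = 1`, scale `1`), `a = p^{1/4}` (`a^{ℓ⋆²} = a⁴ = p`). [folklore] -/
def canonicalPoint : (prototypeDatum p).CanonicalPoint where
  t := p
  t_ne_zero := p_ne_zero p
  absF_t_lt_one := by show absOne p _ < 1; rw [absOne_apply]; exact (norm_p_pos_lt_one p).2
  scale_pt_t := by
    show sc (expQ p (p : PadicAlgCl p)) = 1
    rw [expQ_p, sc_of_pos one_pos]; push_cast; rfl
  a := rootP p 4
  a_pow := by show rootP p 4 ^ (2 ^ 2) = (p : PadicAlgCl p); exact rootP_pow p (by norm_num)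

/-- **The model root tower**: `t = p`, `t^{1/N} := rootP N`. [folklore] -/
def rootTower : (prototypeDatum p).RootTower where
  t := p
  t_ne_zero := p_ne_zero p
  absF_t_lt_one := by show absOne p _ < 1; rw [absOne_apply]; exact (norm_p_pos_lt_one p).2
  scale_pt_t := (canonicalPoint p).scale_pt_t
  root := rootP p
  root_pow N hN := rootP_pow p hN

/-! ## 5. Non-vacuity, packaged, and what the model exhibits -/

/-- **NON-VACUITY with a BIJECTIVE point-Frobenius and `p`-th roots**: E-t3's carriers are simultaneously instantiated (over `Q̄_2`)
by a model whose point-Frobenius is a bijection and whose tilt has `p`-th roots. [folklore] -/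
theorem carriers_nonempty_bijective :
    ∃ (P : PrototypeDatum (PadicAlgCl 2) (ℚ → PadicAlgCl 2) (PadicAlgCl 2) ℚ (fun _ => PadicAlgCl 2) Unit),
      Nonempty P.CanonicalPoint ∧ Nonempty P.RootTower ∧ Function.Bijective P.frobY ∧
        ∀ b : PadicAlgCl 2, ∃ a : PadicAlgCl 2, a ^ P.p = b :=
  haveI : Fact (Nat.Prime 2) := ⟨Nat.prime_two⟩
  ⟨prototypeDatum 2, ⟨canonicalPoint 2⟩, ⟨rootTower 2⟩, frobY_bijective 2, exists_pth_root 2⟩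

/-- Hence E-t3's typed theorems hold IN THIS MODEL as well: Thm. 9.2.1 (`prototypeBound`) and the saturation `|Θ̃|_B ≥ 1`
(`RootTower.one_le_size_thetaLocus`). [folklore] -/
theorem model_prototypeBound_and_saturation :
    ((((prototypeDatum p).abs0 (prototypeDatum p).xi) ^ (prototypeDatum p).lstar : ℝ) : EReal) ≤
        (prototypeDatum p).size (prototypeDatum p).thetaLocus ∧
      (1 : EReal) ≤ (prototypeDatum p).size (prototypeDatum p).thetaLocus :=
  ⟨(prototypeDatum p).prototypeBound (canonicalPoint p), (rootTower p).one_le_size_thetaLocus⟩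

/-- **What the model EXHIBITS (located observation, no verdict)**: the ℓ⋆-tuple of the canonical Ansatz point is the tuple of
exponents `(1/4, 1)` — i.e. `(j²/ℓ⋆²)_j` at `ℓ⋆ = 2`, [J-IIp] (9.2.3) — and nothing else; the typed signature is satisfied by pure
exponent bookkeeping. [folklore] -/
theorem canonical_ansatzPt :
    (prototypeDatum p).ansatzPt (canonicalPoint p).a ⟨0, by show 0 < 2; norm_num⟩ = 1 / 4 ∧
      (prototypeDatum p).ansatzPt (canonicalPoint p).a ⟨1, by show 1 < 2; norm_num⟩ = 1 := by
  have ha : expQ p (rootP p 4) = 1 / 4 := by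
    have h4 : expQ p (rootP p 4 ^ 4) = 4 * expQ p (rootP p 4) := expQ_pow p _ (by norm_num)
    rw [rootP_pow p (by norm_num), expQ_p] at h4
    have : (4 : ℚ) * expQ p (rootP p 4) = 1 := by exact_mod_cast h4.symm
    field_simp
    linarith
  refine ⟨?_, ?_⟩
  · rw [ansatzPt_eq]; show ((((0 : ℕ) + 1) ^ 2 : ℕ) : ℚ) * expQ p (rootP p 4) = 1 / 4; rw [ha]; norm_num
  · rw [ansatzPt_eq]; show ((((1 : ℕ) + 1) ^ 2 : ℕ) : ℚ) * expQ p (rootP p 4) = 1; rw [ha]; norm_num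

end Summit.ABC.IUTFork.Joshi.ExpModel

end
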